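import Mathlib.NumberTheory.Padics.ProperSpace
import Summits.ABC.IUTFork.Joshi.LogShellsBKBridgeNormalised
import HarnessLib

/-!
# Joshi's log-shells — a MODEL of the §9.1.1 signature `BlochKatoDatum` over `ℚ_p` (Iwasawa logarithm), and NON-VACUITY of the
# §9.6–9.7 chain discharged over it (block E, rung LADDER-ABC:A2.E) — no side taken

Block-E record file (seat abc-iut-E-t19; satisfiability / X-04-style model for slot T-19's signature and for the bridges
`Joshi/ThetaEvaluationBridge.lean` (E-t21, p430023) and `Joshi/LogShellsBKBridgeNormalised.lean` (E-t19, p431396)). Source of the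
typed statements: K. Joshi, arXiv:2401.13508 v4 ([J-III], bib `Joshi2024ATS3`, UNREFEREED, rejected by the IUT author
[Mochizuki2024JoshiReport]); what is PROVED here is classical and undisputed (`p`-adic valuation and logarithm on `ℚ_p`).

WHY: every «DISCHARGED over the bridge» theorem of E-t21 / E-t19 is an implication from the FIELDS of `BlochKatoDatum p E H1`
((9.1.1.3) «`H¹(G_E, ℚ_p(1)) ≃ E ⊕ ℚ_p`, `q ↦ (log_E(q), v_E(q))`», (9.1.1.4) `H¹_e = H¹_f ⊊ H¹_st = H¹_g = H¹`); if no datum existed the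
discharges would be vacuous. THIS FILE builds one: `BlochKatoDatum.model p : BlochKatoDatum p ℚ_[p] (ℚ_[p] × ℚ_[p])` with
`H¹ := ℚ_p ⊕ ℚ_p` ITSELF (so `dec = id`), `H¹_e = H¹_f := ℚ_p ⊕ 0`, `H¹_st = H¹_g := ⊤`, the Kummer map
`κ(q) := (log_Iw(q), v_p(q))` with `log_Iw` the IWASAWA logarithm (`log_Iw(q) := log_p(q·p^{−v_p(q)})`, a homomorphism on `ℚ_p^×`
extending OUR `unitLog` on units — PROVED from Literature's `unitLog_mul`), `v_p` Mathlib's `Padic.valuation`, and the integral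
classes `HZ := κ(ℚ_p^×)` (the range of the Kummer homomorphism — the honest integral structure). PROVED: all fields; the
Kummer-theory input `IntegralClassesAreUnitClasses` HOLDS in the model (`model_integralClassesAreUnitClasses`: a class in
`κ(ℚ_p^×) ∩ H¹_e` is `κ(u)` with `v_p(u) = 0`); hence, through the `p*`-normalised bridge, slot T-21's **Prop. 9.7.2.3 (`Prop9723`)
holds UNCONDITIONALLY for the model Tate datum** at any odd `p` (`model_prop9723`) — the whole typed §9.6–9.7.2 chain is
non-vacuously satisfiable. (This is a satisfiability witness for the TYPING, not evidence about Galois cohomology: the model's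
`H¹` is the right-hand side of (9.1.1.3) taken as definition.) Typed ≠ proved ≠ endorsed; nothing here asserts abc, [IUTchIII]
Cor. 3.12, or any claim of [J-III]. [claim: Joshi2024ATS3, status: disputed]
-/

set_option autoImplicit false

noncomputable section

open Set Metric

namespace Summit.ABC.IUTFork.Joshi

open Literature.IUT.LogVolume Literature.AnabelianGeometry.AbsoluteAnabelian

namespace BlochKatoDatum

variable (p : ℕ) [Fact p.Prime]

/-! ## The Iwasawa logarithm on `ℚ_p^×` -/

/-- The unit part `u(q) := q · p^{−v_p(q)}` of `q ∈ ℚ_p^×`. [folklore] -/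
def unitPart (q : ℚ_[p]ˣ) : ℚ_[p] := (q : ℚ_[p]) * (p : ℚ_[p]) ^ (-(q : ℚ_[p]).valuation)

/-- `‖u(q)‖ = 1`. [folklore] -/
theorem norm_unitPart (q : ℚ_[p]ˣ) : ‖unitPart p q‖ = 1 := by
  have hp0 : (0 : ℝ) < p := by exact_mod_cast (Fact.out : p.Prime).pos
  rw [unitPart, norm_mul, norm_zpow, Padic.norm_p, Padic.norm_eq_zpow_neg_valuation q.ne_zero, inv_zpow', neg_neg,
    ← zpow_add₀ hp0.ne', neg_add_cancel, zpow_zero]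

/-- `u(ab) = u(a)·u(b)`. [folklore] -/
theorem unitPart_mul (a b : ℚ_[p]ˣ) : unitPart p (a * b) = unitPart p a * unitPart p b := by
  simp only [unitPart, Units.val_mul]
  rw [Padic.valuation_mul a.ne_zero b.ne_zero, neg_add, zpow_add₀ (Nat.cast_ne_zero.2 (Fact.out : p.Prime).ne_zero)]
  ring

/-- `‖q‖ = 1 ⇒ v_p(q) = 0`. [folklore] -/
theorem valuation_eq_zero_of_norm_eq_one {q : ℚ_[p]} (hq : q ≠ 0) (h : ‖q‖ = 1) : q.valuation = 0 := by
  have hp0 : (0 : ℝ) < p := by exact_mod_cast (Fact.out : p.Prime).pos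
  have hp1 : (p : ℝ) ≠ 1 := by exact_mod_cast (Fact.out : p.Prime).ne_one
  have h' := Padic.norm_eq_zpow_neg_valuation hq
  rw [h, ← zpow_zero (p : ℝ)] at h'
  have := zpow_right_injective₀ hp0 hp1 h'
  omega

/-- `v_p(q) = 0 ⇒ ‖q‖ = 1`. [folklore] -/
theorem norm_eq_one_of_valuation_eq_zero {q : ℚ_[p]} (hq : q ≠ 0) (h : q.valuation = 0) : ‖q‖ = 1 := by
  rw [Padic.norm_eq_zpow_neg_valuation hq, h, neg_zero, zpow_zero]

/-- On units, `u(q) = q`. [folklore] -/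
theorem unitPart_of_norm_eq_one {q : ℚ_[p]ˣ} (h : ‖(q : ℚ_[p])‖ = 1) : unitPart p q = q := by
  rw [unitPart, valuation_eq_zero_of_norm_eq_one p q.ne_zero h, neg_zero, zpow_zero, mul_one]

/-- **The Iwasawa logarithm** `log_Iw : ℚ_p^× → ℚ_p`, `log_Iw(q) := log_p(q · p^{−v_p(q)})` (so `log_Iw(p) = 0`), built on OUR `unitLog`.
[folklore] -/
def logIw (q : ℚ_[p]ˣ) : ℚ_[p] := unitLog (unitPart p q)

/-- `log_Iw` is a homomorphism (from Literature's `unitLog_mul` on units of `ℚ_p`). [folklore] -/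
theorem logIw_mul (a b : ℚ_[p]ˣ) : logIw p (a * b) = logIw p a + logIw p b := by
  rw [logIw, unitPart_mul, unitLog_mul p (norm_unitPart p a) (norm_unitPart p b), logIw, logIw]

/-- On units `log_Iw = log_p = unitLog`. [folklore] -/
theorem logIw_of_norm_eq_one {q : ℚ_[p]ˣ} (h : ‖(q : ℚ_[p])‖ = 1) : logIw p q = unitLog (q : ℚ_[p]) := by
  rw [logIw, unitPart_of_norm_eq_one p h]

/-- The valuation `v_p : ℚ_p^× → ℤ` (Mathlib's `Padic.valuation`). [folklore] -/
def valZ (q : ℚ_[p]ˣ) : ℤ := (q : ℚ_[p]).valuation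

/-- `v_p(q) = 0 ↔ ‖q‖ = 1`. [folklore] -/
theorem valZ_eq_zero_iff (q : ℚ_[p]ˣ) : valZ p q = 0 ↔ ‖(q : ℚ_[p])‖ = 1 :=
  ⟨norm_eq_one_of_valuation_eq_zero p q.ne_zero, valuation_eq_zero_of_norm_eq_one p q.ne_zero⟩

/-- **The Kummer map of the model**, as a homomorphism `ℚ_p^× → ℚ_p ⊕ ℚ_p`, `q ↦ (log_Iw(q), v_p(q))` — the right-hand side of
(9.1.1.3) «explicitly given as `q ↦ (log_E(q), v_E(q))`». [folklore] -/
def kummerHom : Additive ℚ_[p]ˣ →+ ℚ_[p] × ℚ_[p] :=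
  AddMonoidHom.mk' (fun q => (logIw p (Additive.toMul q), ((valZ p (Additive.toMul q) : ℤ) : ℚ_[p]))) fun a b => by
    show (logIw p (Additive.toMul a * Additive.toMul b), ((valZ p (Additive.toMul a * Additive.toMul b) : ℤ) : ℚ_[p])) = _
    rw [Prod.mk_add_mk, logIw_mul, valZ, Units.val_mul, Padic.valuation_mul (Additive.toMul a).ne_zero (Additive.toMul b).ne_zero,
      Int.cast_add]
    rfl

/-! ## The model -/

/-- **A MODEL of the §9.1.1 signature over `E = ℚ_p`**: `H¹ := ℚ_p ⊕ ℚ_p` (the target of (9.1.1.3) itself, `dec = id`),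
`H¹_e = H¹_f := ℚ_p ⊕ 0`, `H¹_st = H¹_g := ⊤`, `κ(q) := (log_Iw(q), v_p(q))`, `HZ := κ(ℚ_p^×)`, `log_E := log_Iw`, `v_E := v_p`.
Every field PROVED. A satisfiability witness for the typing (not a statement about Galois cohomology). [folklore] -/
def model : BlochKatoDatum p ℚ_[p] (ℚ_[p] × ℚ_[p]) where
  He := LinearMap.ker ((LinearMap.snd ℚ_[p] ℚ_[p] ℚ_[p]).comp (LinearEquiv.refl ℚ_[p] (ℚ_[p] × ℚ_[p])).toLinearMap)
  Hf := LinearMap.ker ((LinearMap.snd ℚ_[p] ℚ_[p] ℚ_[p]).comp (LinearEquiv.refl ℚ_[p] (ℚ_[p] × ℚ_[p])).toLinearMap)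
  Hst := ⊤
  Hg := ⊤
  HZ := (kummerHom p).range
  kummer q := kummerHom p (Additive.ofMul q)
  kummer_mul a b := by rw [ofMul_mul, map_add]
  kummer_mem_HZ q := ⟨Additive.ofMul q, rfl⟩
  val := valZ p
  val_eq_zero_iff := valZ_eq_zero_iff p
  logE := logIw p
  logE_of_norm_eq_one q h := logIw_of_norm_eq_one p h
  dec := LinearEquiv.refl ℚ_[p] (ℚ_[p] × ℚ_[p])
  dec_kummer _ := rfl
  Hf_eq_ker := rfl
  He_eq_Hf := rfl
  Hf_lt_Hst := by
    refine lt_top_iff_ne_top.2 fun h => ?_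
    have hmem : ((0 : ℚ_[p]), (1 : ℚ_[p])) ∈
        LinearMap.ker ((LinearMap.snd ℚ_[p] ℚ_[p] ℚ_[p]).comp (LinearEquiv.refl ℚ_[p] (ℚ_[p] × ℚ_[p])).toLinearMap) := by
      rw [h]; exact Submodule.mem_top
    rw [LinearMap.mem_ker] at hmem
    exact one_ne_zero hmem
  Hst_eq_Hg := rfl
  Hg_eq_top := rfl

/-- In the model, `dec` is the identity. [folklore] -/
@[simp] theorem model_dec (x : ℚ_[p] × ℚ_[p]) : (model p).dec x = x := rfl

/-- In the model, `κ(q) = (log_Iw(q), v_p(q))`. [folklore] -/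
theorem model_kummer (q : ℚ_[p]ˣ) : (model p).kummer q = (logIw p q, ((valZ p q : ℤ) : ℚ_[p])) := rfl

/-- In the model, the integral classes are exactly the Kummer classes. [folklore] -/
theorem model_mem_HZ_iff (x : ℚ_[p] × ℚ_[p]) : x ∈ (model p).HZ ↔ ∃ q : ℚ_[p]ˣ, (model p).kummer q = x :=
  ⟨fun ⟨a, ha⟩ => ⟨Additive.toMul a, ha⟩, fun ⟨q, hq⟩ => ⟨Additive.ofMul q, hq⟩⟩

/-- **The Kummer-theory input HOLDS in the model**: an integral class lying in `H¹_e` is the class of a unit (its valuation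
component vanishes). [folklore] -/
theorem model_integralClassesAreUnitClasses : (model p).IntegralClassesAreUnitClasses := by
  intro x hx
  rw [(model p).mem_integral_iff] at hx
  obtain ⟨q, rfl⟩ := (model_mem_HZ_iff p _).1 hx.1
  have h1 : ‖(q : ℚ_[p])‖ = 1 := ((model p).kummer_mem_He_iff_norm q).1 hx.2
  exact ⟨q, h1, rfl⟩

/-- Hence `toE″(HZ ∩ H¹_e) = log_p(ℤ_p^×)` in the model. [folklore] -/
theorem model_toE_image_integral_eq :
    (model p).toE '' ((model p).integral (model p).He : Set (ℚ_[p] × ℚ_[p])) = logUnits ℚ_[p] :=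
  (model p).toE_image_integral_eq (model_integralClassesAreUnitClasses p)

/-! ## Non-vacuity of the discharged §9.6–9.7 chain -/

/-- **Prop. 9.7.2.3, first clause (`LogShellEqLogBKImage`), holds UNCONDITIONALLY for the model's normalised local datum**
(`I = (1/p*)·log_p(ℤ_p^×) = log_BK(H¹_e(ℤ_p(1)))` with the `p*`-normalised `log_BK`). [folklore] -/
theorem model_logShellEqLogBKImage : (model p).bkDatumNormalised.LogShellEqLogBKImage :=
  (model p).bkDatumNormalised_logShellEqLogBKImage (model_integralClassesAreUnitClasses p)

/-- **NON-VACUITY WITNESS**: for odd `p`, any `ℓ ≥ 1` and any `q^{1/2ℓ} ∈ pℤ_p ∖ 0` (e.g. `q^{1/2ℓ} = p`), slot T-21's `Prop9723`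
(Prop. 9.7.2.3, both clauses) HOLDS for the model Tate datum — so the typed §9.6–9.7.2 chain (`H1eEqH1f`, `OneUnitsKummerFontaine`,
`PrincipalUnitsCrystalline`, `LogBKPrincipalUnits`, `XiCrystalline`, `LogBKXiFormula`, `LogShellEqLogBKImage`, `Prop9723`) is
simultaneously satisfiable. [folklore] -/
theorem model_prop9723 (hp2 : p ≠ 2) (l : ℕ) (hl : 1 ≤ l) (q2l : ℚ_[p]) (hq0 : q2l ≠ 0) (hq1 : ‖q2l‖ < 1) :
    ((model p).tateDatumNormalised hp2 l hl q2l hq0 hq1).Prop9723 :=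
  (model p).tateDatumNormalised_prop9723 hp2 l hl q2l hq0 hq1 (model_integralClassesAreUnitClasses p)

/-- The witness instantiated at `q^{1/2ℓ} := p`, `ℓ := 1`: for every odd prime `p` there IS a Tate datum satisfying `Prop9723`.
[folklore] -/
theorem exists_tateDatum_prop9723 (hp2 : p ≠ 2) :
    ∃ T : ATS3.TateLocalDatum ℚ_[p] (model p).HZ (ℚ_[p] × ℚ_[p]), T.Prop9723 :=
  ⟨(model p).tateDatumNormalised hp2 1 le_rfl (p : ℚ_[p]) (Nat.cast_ne_zero.2 (Fact.out : p.Prime).ne_zero) Padic.norm_p_lt_one,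
    model_prop9723 p hp2 1 le_rfl _ _ _⟩

end BlochKatoDatum

end Summit.ABC.IUTFork.Joshi

end
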